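import Mathlib
import HarnessLib
import Summits.ValiantsHypothesis.ValiantsHypothesis.Theorems.LacunarySymmetroidMatrixDescartesProductPlusOneEulerSharpK

/-!
# ValiantsHypothesis / LacunarySymmetroid — crux `MatrixDescartes` (stmt-ValiantsHypothesis-18050, V1),
# LINE (A) «product_plus_one», floor stub `OneChangeFloorK3`: the RICCATI STRUCTURE of a trinomial's Euler ratio

Structure lemmas for the research floor of LINE (A) (val-idea-25 rev 15 `OneChangeFloorK3`; memo
`pub/val-lit/lmr/NOTE-p7g15-18050-LINEA-incoherent-cell.md` §3/§7).  For a trinomial `F(x) = a x^e + b x^{e+p} + c x^{e+q}` (`0 < p ≤ q`) put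
`N = p b x^{e+p} + q c x^{e+q}` (the Euler letter `X F′ − e F` at `x`), `M = p² b x^{e+p} + q² c x^{e+q}` (`X N′ − e N` at `x`) and the Euler ratio
`Φ = N/F` (so the c-free Euler numerator of a product vanishes exactly where `Σ_j Φ_j = 0`, bottom coupling).  Then, with NO sign hypothesis:

* `eval_euler_trinomial` — the bridge `(X F′ − e F).eval x = N`;
* `riccati_identity` — `F·M − N² = (N − pF)(qF − N) + p q · a x^e · F`;
* `hasDerivAt_eulerRatio` — `Φ′(x) = ((Φ − p)(q − Φ) + p q · a x^e / F) / x` for `x > 0`, `F(x) ≠ 0` — a RICCATI equation for `Φ` in `log x` with the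
  single «drag» term `p q · a x^e/F` (the relative weight of the bottom letter);

and the three sign readings used by the memo (all at a point `x > 0`):
* `drag_nonpos_of_switched` / `eulerRatio_gt_of_switched` — a SWITCHED factor (`a·F(x) < 0`, the bottom letter outweighed): `x Φ′ ≤ (Φ − p)(q − Φ)`,
  and if its upper letters oppose the bottom one (`a c ≤ 0`, middle free) `p < Φ` — a logistic-dominated RISE from `p` to `q`;
* `puller_bound` — an UNSWITCHED incoherent factor (`a·F(x) > 0`, `a b ≤ 0`, `a c ≤ 0`): `ψ = −Φ ≥ 0` and `x ψ′ ≥ ψ(ψ + p)` — a convex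
  hyperbolic PULL (it blows up at the factor's zero);
* `drag_of_oneSigned` — a one-signed factor (`a b ≥ 0`, `a c ≥ 0`, `a ≠ 0`): the bottom weight `a x^e/F ∈ (0,1]`, so
  `(Φ − p)(q − Φ) < x Φ′ ≤ (Φ − p)(q − Φ) + p q` — also a riser.

* §3 `eval_eulerNumerator_eq_prod_mul_sum` (`R(x) = ∏ f_j(x)·Σ_j Φ_j(x)`, every format) and, for K = 3 in the shape `![d₀, d₀+p, d₀+q]`,
  ★ `eulerNumerator_eval_ne_zero_of_all_switched` / `…_of_all_unswitched`: for incoherent one-zero factors the c-free Euler numerator has NO zero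
  at a point where every factor is switched (all `Φ_j > p`) or every factor is unswitched (all `Φ_j ≤ 0`, one `< 0`) — all its positive zeros are
  trapped between the smallest and the largest factor zero (crit-6 g2's «all steps in the top gap» design carries none there).

(At `q ≤ 4p` the riser slack `(Φ−p)(q−Φ) − pΦ ≤ p²((q/p)²/4 − q/p) ≤ 0` is what makes the tame sector work; above it the floor is «risers against
pullers», memo §4–§7.)  Honest framing: calculus identities; nothing here bounds a zero count; NOT `OneChangeFloorK3` / `stub_classRowK3` /
`stub_polyLaw` / `MatrixDescartes` / B; `VP ≠ VNP` NOT proved.  No definitions, no named facts; Mathlib only.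
-/

set_option linter.dupNamespace false

namespace Summit.ValiantsHypothesis.ValiantsHypothesis.Theorems.LacunarySymmetroidMatrixDescartes

namespace ProductPlusOne

open Polynomial

/-! ### §1 The identity and the Riccati equation -/

/-- **`F·M − N² = (N − pF)(qF − N) + p q·a x^e·F`** for a trinomial and its two Euler letters. [folklore] -/
theorem riccati_identity (a b c x : ℝ) (e p q : ℕ) :
    (a * x ^ e + b * x ^ (e + p) + c * x ^ (e + q)) * ((p : ℝ) ^ 2 * b * x ^ (e + p) + (q : ℝ) ^ 2 * c * x ^ (e + q))
        - ((p : ℝ) * b * x ^ (e + p) + (q : ℝ) * c * x ^ (e + q)) ^ 2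
      = (((p : ℝ) * b * x ^ (e + p) + (q : ℝ) * c * x ^ (e + q)) - (p : ℝ) * (a * x ^ e + b * x ^ (e + p) + c * x ^ (e + q)))
          * ((q : ℝ) * (a * x ^ e + b * x ^ (e + p) + c * x ^ (e + q)) - ((p : ℝ) * b * x ^ (e + p) + (q : ℝ) * c * x ^ (e + q)))
        + (p : ℝ) * q * (a * x ^ e) * (a * x ^ e + b * x ^ (e + p) + c * x ^ (e + q)) := by
  ring

/-- The Euler letter of the trinomial as a polynomial evaluation: `(X F′ − e F)(x) = p b x^{e+p} + q c x^{e+q}`. [folklore] -/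
theorem eval_euler_trinomial (a b c x : ℝ) (e p q : ℕ) :
    (X * derivative (C a * X ^ e + C b * X ^ (e + p) + C c * X ^ (e + q) : ℝ[X])
        - C (e : ℝ) * (C a * X ^ e + C b * X ^ (e + p) + C c * X ^ (e + q))).eval x
      = (p : ℝ) * b * x ^ (e + p) + (q : ℝ) * c * x ^ (e + q) := by
  have key : ∀ (w : ℝ) (n : ℕ), x * (derivative (C w * X ^ n : ℝ[X])).eval x = (n : ℝ) * w * x ^ n := by
    intro w n
    rw [derivative_C_mul_X_pow, eval_mul, eval_C, eval_pow, eval_X]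
    rcases Nat.eq_zero_or_pos n with h0 | hpos
    · subst h0; simp
    · have : x * x ^ (n - 1) = x ^ n := by
        rw [← pow_succ', Nat.sub_add_cancel hpos]
      calc x * (w * (n : ℝ) * x ^ (n - 1)) = (n : ℝ) * w * (x * x ^ (n - 1)) := by ring
        _ = (n : ℝ) * w * x ^ n := by rw [this]
  simp only [derivative_add, mul_add, eval_sub, eval_add, eval_mul, eval_C, eval_pow, eval_X]
  rw [key a e, key b (e + p), key c (e + q)]
  push_cast
  ring

/-- ★ **The Riccati equation of the Euler ratio**: for `x > 0` with `F(x) ≠ 0`, `Φ = N/F` satisfies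
`Φ′(x) = ((Φ − p)(q − Φ) + p q·a x^e/F(x)) / x`. [this file's theorem] -/
theorem hasDerivAt_eulerRatio (a b c : ℝ) (e p q : ℕ) {x : ℝ} (hx : 0 < x)
    (hF : a * x ^ e + b * x ^ (e + p) + c * x ^ (e + q) ≠ 0) :
    HasDerivAt (fun y : ℝ => ((p : ℝ) * b * y ^ (e + p) + (q : ℝ) * c * y ^ (e + q)) / (a * y ^ e + b * y ^ (e + p) + c * y ^ (e + q)))
      (((((p : ℝ) * b * x ^ (e + p) + (q : ℝ) * c * x ^ (e + q)) / (a * x ^ e + b * x ^ (e + p) + c * x ^ (e + q)) - p)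
          * (q - ((p : ℝ) * b * x ^ (e + p) + (q : ℝ) * c * x ^ (e + q)) / (a * x ^ e + b * x ^ (e + p) + c * x ^ (e + q)))
        + (p : ℝ) * q * (a * x ^ e / (a * x ^ e + b * x ^ (e + p) + c * x ^ (e + q)))) / x) x := by
  set F : ℝ → ℝ := fun y => a * y ^ e + b * y ^ (e + p) + c * y ^ (e + q) with hFdef
  set N : ℝ → ℝ := fun y => (p : ℝ) * b * y ^ (e + p) + (q : ℝ) * c * y ^ (e + q) with hNdef
  -- derivatives of `F` and `N` at `x`, written as `F′ = (eF + N)/x`, `N′ = (eN + M)/x`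
  have hpow : ∀ (n : ℕ), HasDerivAt (fun y : ℝ => y ^ n) ((n : ℝ) * x ^ n / x) x := by
    intro n
    have h := hasDerivAt_pow n x
    rcases Nat.eq_zero_or_pos n with h0 | hpos
    · subst h0; simpa using h
    · have e1 : (n : ℝ) * x ^ (n - 1) = (n : ℝ) * x ^ n / x := by
        rw [eq_div_iff hx.ne', mul_assoc, ← pow_succ, Nat.sub_add_cancel hpos]
      rw [← e1]; exact h
  have hF' : HasDerivAt F (((e : ℝ) * F x + N x) / x) x := by
    have h := ((hpow e).const_mul a).add (((hpow (e + p)).const_mul b).add ((hpow (e + q)).const_mul c))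
    have e1 : a * ((e : ℝ) * x ^ e / x) + (b * (((e + p : ℕ) : ℝ) * x ^ (e + p) / x) + c * (((e + q : ℕ) : ℝ) * x ^ (e + q) / x))
        = ((e : ℝ) * F x + N x) / x := by
      simp only [hFdef, hNdef]; push_cast; field_simp; ring
    rw [← e1]
    refine h.congr_of_eventuallyEq (Filter.Eventually.of_forall fun y => ?_)
    show F y = a * y ^ e + (b * y ^ (e + p) + c * y ^ (e + q))
    simp only [hFdef]; ring
  have hN' : HasDerivAt N (((e : ℝ) * N x + ((p : ℝ) ^ 2 * b * x ^ (e + p) + (q : ℝ) ^ 2 * c * x ^ (e + q))) / x) x := by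
    have h := ((hpow (e + p)).const_mul ((p : ℝ) * b)).add ((hpow (e + q)).const_mul ((q : ℝ) * c))
    have e1 : (p : ℝ) * b * (((e + p : ℕ) : ℝ) * x ^ (e + p) / x) + (q : ℝ) * c * (((e + q : ℕ) : ℝ) * x ^ (e + q) / x)
        = ((e : ℝ) * N x + ((p : ℝ) ^ 2 * b * x ^ (e + p) + (q : ℝ) ^ 2 * c * x ^ (e + q))) / x := by
      simp only [hNdef]; push_cast; field_simp; ring
    rw [← e1]
    refine h.congr_of_eventuallyEq (Filter.Eventually.of_forall fun y => ?_)
    show N y = (p : ℝ) * b * y ^ (e + p) + (q : ℝ) * c * y ^ (e + q)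
    simp only [hNdef]
  have hFx : F x ≠ 0 := hF
  have hquot := hN'.div hF' hFx
  -- the quotient-rule value equals the Riccati value
  have hid := riccati_identity a b c x e p q
  have e2 : ((((e : ℝ) * N x + ((p : ℝ) ^ 2 * b * x ^ (e + p) + (q : ℝ) ^ 2 * c * x ^ (e + q))) / x) * F x
        - N x * (((e : ℝ) * F x + N x) / x)) / F x ^ 2
      = (((N x / F x - p) * (q - N x / F x)) + (p : ℝ) * q * (a * x ^ e / F x)) / x := by
    simp only [hFdef, hNdef] at hid hFx ⊢
    field_simp
    linear_combination hid
  rw [e2] at hquot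
  exact hquot

/-! ### §2 The sign readings (pure inequalities on the right-hand side of the Riccati equation) -/

/-- **RISER: the drag is nonpositive for a SWITCHED factor** (`a·F(x) < 0`): so `x·Φ′ ≤ (Φ − p)(q − Φ)`. [this file's lemma] -/
theorem drag_nonpos_of_switched (a b c : ℝ) (e p q : ℕ) {x : ℝ} (hx : 0 < x)
    (hsw : a * (a * x ^ e + b * x ^ (e + p) + c * x ^ (e + q)) < 0) :
    (p : ℝ) * q * (a * x ^ e / (a * x ^ e + b * x ^ (e + p) + c * x ^ (e + q))) ≤ 0 := by
  set F := a * x ^ e + b * x ^ (e + p) + c * x ^ (e + q) with hF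
  have hF0 : F ≠ 0 := by intro h; rw [h, mul_zero] at hsw; exact lt_irrefl 0 hsw
  have h1 : a * x ^ e / F = (a * F) * x ^ e / F ^ 2 := by field_simp
  have h2 : (a * F) * x ^ e / F ^ 2 < 0 :=
    div_neg_of_neg_of_pos (mul_neg_of_neg_of_pos hsw (pow_pos hx e)) (by positivity)
  rw [h1]
  exact mul_nonpos_of_nonneg_of_nonpos (by positivity) h2.le

/-- **RISER: a switched factor whose upper letters oppose the bottom one has `Φ > p`** (`0 < p ≤ q`, `a c ≤ 0`, `a·F(x) < 0`; the middle sign is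
free): the rise runs from `p` to `q`. [this file's lemma] -/
theorem eulerRatio_gt_of_switched (a b c : ℝ) (e p q : ℕ) (hp : 0 < p) (hpq : p ≤ q) {x : ℝ} (hx : 0 < x) (hac : a * c ≤ 0)
    (hsw : a * (a * x ^ e + b * x ^ (e + p) + c * x ^ (e + q)) < 0) :
    (p : ℝ) < ((p : ℝ) * b * x ^ (e + p) + (q : ℝ) * c * x ^ (e + q)) / (a * x ^ e + b * x ^ (e + p) + c * x ^ (e + q)) := by
  set F := a * x ^ e + b * x ^ (e + p) + c * x ^ (e + q) with hF
  set N := (p : ℝ) * b * x ^ (e + p) + (q : ℝ) * c * x ^ (e + q) with hN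
  have hF0 : F ≠ 0 := by intro h; rw [h, mul_zero] at hsw; exact lt_irrefl 0 hsw
  have ha0 : a ≠ 0 := by intro h; rw [h, zero_mul] at hsw; exact lt_irrefl 0 hsw
  have hpR : (0 : ℝ) < p := by exact_mod_cast hp
  have hqp : (0 : ℝ) ≤ (q : ℝ) - p := by have := (Nat.cast_le (α := ℝ)).2 hpq; linarith
  have hnum : a * (N - (p : ℝ) * F) < 0 := by
    have e1 : a * (N - (p : ℝ) * F) = ((q : ℝ) - p) * (a * c) * x ^ (e + q) - (p : ℝ) * (a * a) * x ^ e := by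
      simp only [hN, hF]; ring
    rw [e1]
    have h1 : ((q : ℝ) - p) * (a * c) * x ^ (e + q) ≤ 0 :=
      mul_nonpos_of_nonpos_of_nonneg (mul_nonpos_of_nonneg_of_nonpos hqp hac) (pow_pos hx _).le
    have h2 : 0 < (p : ℝ) * (a * a) * x ^ e := mul_pos (mul_pos hpR (mul_self_pos.2 ha0)) (pow_pos hx e)
    linarith
  have hquot : 0 < (a * (N - (p : ℝ) * F)) / (a * F) := div_pos_of_neg_of_neg hnum hsw
  rw [mul_div_mul_left _ _ ha0] at hquot
  have e2 : (N - (p : ℝ) * F) / F = N / F - p := by field_simp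
  rw [e2] at hquot
  linarith

/-- **PULLER: an unswitched incoherent factor** (`p ≤ q`; `a b ≤ 0`, `a c ≤ 0`, `a·F(x) > 0`): with `Φ = N/F`, `ψ = −Φ ≥ 0` and the Riccati
right-hand side satisfies `−((Φ−p)(q−Φ) + p q·a x^e/F) ≥ ψ(ψ + p)`, i.e. `x·ψ′ ≥ ψ(ψ + p)` — a convex hyperbolic pull. [this file's lemma] -/
theorem puller_bound (a b c : ℝ) (e p q : ℕ) (hpq : p ≤ q) {x : ℝ} (hx : 0 < x) (hab : a * b ≤ 0) (hac : a * c ≤ 0)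
    (hun : 0 < a * (a * x ^ e + b * x ^ (e + p) + c * x ^ (e + q))) (Φ : ℝ)
    (hΦ : Φ = ((p : ℝ) * b * x ^ (e + p) + (q : ℝ) * c * x ^ (e + q)) / (a * x ^ e + b * x ^ (e + p) + c * x ^ (e + q))) :
    0 ≤ -Φ ∧ (-Φ) * (-Φ + p) ≤ -((Φ - p) * (q - Φ) + (p : ℝ) * q * (a * x ^ e / (a * x ^ e + b * x ^ (e + p) + c * x ^ (e + q)))) := by
  set F := a * x ^ e + b * x ^ (e + p) + c * x ^ (e + q) with hF
  set N := (p : ℝ) * b * x ^ (e + p) + (q : ℝ) * c * x ^ (e + q) with hN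
  have hF0 : F ≠ 0 := by intro h; rw [h, mul_zero] at hun; exact lt_irrefl 0 hun
  have ha0 : a ≠ 0 := by intro h; rw [h, zero_mul] at hun; exact lt_irrefl 0 hun
  have hqp : (0 : ℝ) ≤ (q : ℝ) - p := by have := (Nat.cast_le (α := ℝ)).2 hpq; linarith
  -- `ψ = a(−N)/(aF)` with `a(−N) ≥ 0`
  have hψ : 0 ≤ -Φ := by
    have e1 : -Φ = (a * -N) / (a * F) := by rw [hΦ, mul_div_mul_left _ _ ha0, neg_div]
    have hnum : 0 ≤ a * -N := by
      have : a * -N = -(p : ℝ) * (a * b) * x ^ (e + p) + -(q : ℝ) * (a * c) * x ^ (e + q) := by simp only [hN]; ring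
      rw [this]
      have h1 : 0 ≤ -(p : ℝ) * (a * b) * x ^ (e + p) :=
        mul_nonneg (by nlinarith [Nat.cast_nonneg (α := ℝ) p]) (pow_pos hx _).le
      have h2 : 0 ≤ -(q : ℝ) * (a * c) * x ^ (e + q) :=
        mul_nonneg (by nlinarith [Nat.cast_nonneg (α := ℝ) q]) (pow_pos hx _).le
      linarith
    rw [e1]; exact div_nonneg hnum hun.le
  refine ⟨hψ, ?_⟩
  -- the difference is `q (q−p) x^{e+q} · (−ac)/(aF) ≥ 0`
  have key : -((Φ - p) * (q - Φ) + (p : ℝ) * q * (a * x ^ e / F)) - (-Φ) * (-Φ + p)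
      = (q : ℝ) * ((q : ℝ) - p) * x ^ (e + q) * ((a * -c) / (a * F)) := by
    rw [mul_div_mul_left _ _ ha0, hΦ]
    field_simp
    ring
  have hpos : 0 ≤ (q : ℝ) * ((q : ℝ) - p) * x ^ (e + q) * ((a * -c) / (a * F)) := by
    have h1 : 0 ≤ (a * -c) / (a * F) := div_nonneg (by nlinarith) hun.le
    have h2 : 0 ≤ (q : ℝ) * ((q : ℝ) - p) * x ^ (e + q) :=
      mul_nonneg (mul_nonneg (Nat.cast_nonneg q) hqp) (pow_pos hx _).le
    exact mul_nonneg h2 h1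
  linarith

/-- **ONE-SIGNED factor** (`a b ≥ 0`, `a c ≥ 0`, `a ≠ 0`): the bottom weight `a x^e/F` lies in `(0, 1]`, so the drag is in `(0, p q]` and
`(Φ−p)(q−Φ) < x·Φ′ ≤ (Φ−p)(q−Φ) + p q` — a riser as well. [this file's lemma] -/
theorem drag_of_oneSigned (a b c : ℝ) (e p q : ℕ) {x : ℝ} (hx : 0 < x) (ha : a ≠ 0) (hab : 0 ≤ a * b) (hac : 0 ≤ a * c) :
    0 < a * x ^ e / (a * x ^ e + b * x ^ (e + p) + c * x ^ (e + q)) ∧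
      a * x ^ e / (a * x ^ e + b * x ^ (e + p) + c * x ^ (e + q)) ≤ 1 := by
  set F := a * x ^ e + b * x ^ (e + p) + c * x ^ (e + q) with hF
  have haF : 0 < a * F := by
    have : a * F = (a * a) * x ^ e + (a * b) * x ^ (e + p) + (a * c) * x ^ (e + q) := by simp only [hF]; ring
    rw [this]
    have h1 : 0 < (a * a) * x ^ e := mul_pos (mul_self_pos.2 ha) (pow_pos hx e)
    have h2 : 0 ≤ (a * b) * x ^ (e + p) := mul_nonneg hab (pow_pos hx _).le
    have h3 : 0 ≤ (a * c) * x ^ (e + q) := mul_nonneg hac (pow_pos hx _).le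
    linarith
  have e1 : a * x ^ e / F = (a * (a * x ^ e)) / (a * F) := by rw [mul_div_mul_left _ _ ha]
  rw [e1]
  constructor
  · have : 0 < a * (a * x ^ e) := by
      have h := mul_pos (mul_self_pos.2 ha) (pow_pos hx e)
      linarith [show a * (a * x ^ e) = a * a * x ^ e by ring]
    exact div_pos this haF
  · rw [div_le_one haF]
    have : a * F - a * (a * x ^ e) = (a * b) * x ^ (e + p) + (a * c) * x ^ (e + q) := by simp only [hF]; ring
    nlinarith [mul_nonneg hab (pow_pos hx (e + p)).le, mul_nonneg hac (pow_pos hx (e + q)).le]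


/-! ### §3 Consequence for the line's Euler numerator at K = 3: no zero where ALL factors are switched, or ALL unswitched -/

/-- `R(x) = (∏_j f_j(x)) · Σ_j (X f_j′ − d₀ f_j)(x)/f_j(x)` off the zeros of the factors (every format). [folklore] -/
theorem eval_eulerNumerator_eq_prod_mul_sum {m K : ℕ} (d : Fin K → ℕ) (a : Fin m → Fin K → ℝ) (l₀ : Fin K) {x : ℝ}
    (hf : ∀ j, (∑ l, C (a j l) * X ^ (d l) : ℝ[X]).eval x ≠ 0) :
    (∑ j, (∑ l, C (a j l * ((d l : ℝ) - d l₀)) * X ^ (d l)) * ∏ i ∈ Finset.univ.erase j, (∑ l, C (a i l) * X ^ (d l)) : ℝ[X]).eval x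
      = (∏ j, (∑ l, C (a j l) * X ^ (d l) : ℝ[X]).eval x)
        * ∑ j, (X * derivative (∑ l, C (a j l) * X ^ (d l) : ℝ[X]) - C ((d l₀ : ℕ) : ℝ) * ∑ l, C (a j l) * X ^ (d l)).eval x
            / (∑ l, C (a j l) * X ^ (d l) : ℝ[X]).eval x := by
  classical
  rw [eulerNumerator_eq_general, eval_sub, eval_mul, eval_X, eval_mul, eval_C,
    eval_euler_prod_general (fun j => (∑ l, C (a j l) * X ^ (d l) : ℝ[X])) hf, eval_prod]
  have hm : ((m : ℝ) * (d l₀ : ℝ)) = ∑ _j : Fin m, ((d l₀ : ℕ) : ℝ) := by simp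
  rw [hm, Finset.mul_sum, Finset.sum_mul, ← Finset.sum_sub_distrib, Finset.mul_sum]
  refine Finset.sum_congr rfl fun j _ => ?_
  have hfj := hf j
  simp only [eval_sub, eval_mul, eval_X, eval_C]
  field_simp

/-- For K = 3 (`d 1 = d 0 + p`, `d 2 = d 0 + q`): the factor and its Euler letter in the `e, e+p, e+q` form of §1. [folklore] -/
theorem eval_trinomial_three (d0 p q : ℕ) (b : Fin 3 → ℝ) (x : ℝ) :
    (∑ l, C (b l) * X ^ ((![d0, d0 + p, d0 + q] : Fin 3 → ℕ) l) : ℝ[X]).eval x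
      = b 0 * x ^ d0 + b 1 * x ^ (d0 + p) + b 2 * x ^ (d0 + q) ∧
    (X * derivative (∑ l, C (b l) * X ^ ((![d0, d0 + p, d0 + q] : Fin 3 → ℕ) l) : ℝ[X])
        - C ((((![d0, d0 + p, d0 + q] : Fin 3 → ℕ) 0 : ℕ) : ℝ)) * ∑ l, C (b l) * X ^ ((![d0, d0 + p, d0 + q] : Fin 3 → ℕ) l)).eval x
      = (p : ℝ) * b 1 * x ^ (d0 + p) + (q : ℝ) * b 2 * x ^ (d0 + q) := by
  constructor
  · simp [Fin.sum_univ_three]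
  · rw [euler_fewnomial]
    simp [Fin.sum_univ_three]
    ring

/-- ★ **No Euler zero where every factor is SWITCHED** (K = 3, support `(d₀, d₀+p, d₀+q)`, `0 < p ≤ q`, `m ≥ 1`; each factor with
`a_{j0} a_{j2} ≤ 0` and `a_{j0}·f_j(x) < 0`): `R(x) ≠ 0` — every Euler ratio exceeds `p` (`eulerRatio_gt_of_switched`).  In crit-6 g2's design
(all zeros low, all steps high) this is why the top gap carries no zero of `R`. [this file's theorem] -/
theorem eulerNumerator_eval_ne_zero_of_all_switched {m : ℕ} (hm : 0 < m) (d0 p q : ℕ) (hp : 0 < p) (hpq : p ≤ q)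
    (a : Fin m → Fin 3 → ℝ) {x : ℝ} (hx : 0 < x) (hac : ∀ j, a j 0 * a j 2 ≤ 0)
    (hsw : ∀ j, a j 0 * (a j 0 * x ^ d0 + a j 1 * x ^ (d0 + p) + a j 2 * x ^ (d0 + q)) < 0) :
    (∑ j, (∑ l, C (a j l * (((![d0, d0 + p, d0 + q] : Fin 3 → ℕ) l : ℝ) - (![d0, d0 + p, d0 + q] : Fin 3 → ℕ) 0)) *
        X ^ ((![d0, d0 + p, d0 + q] : Fin 3 → ℕ) l)) *
      ∏ i ∈ Finset.univ.erase j, (∑ l, C (a i l) * X ^ ((![d0, d0 + p, d0 + q] : Fin 3 → ℕ) l)) : ℝ[X]).eval x ≠ 0 := by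
  classical
  set d : Fin 3 → ℕ := ![d0, d0 + p, d0 + q] with hd
  have hev := fun j => eval_trinomial_three d0 p q (a j) x
  have hf : ∀ j, (∑ l, C (a j l) * X ^ (d l) : ℝ[X]).eval x ≠ 0 := by
    intro j h
    have := hsw j
    rw [← (hev j).1, h, mul_zero] at this
    exact lt_irrefl 0 this
  rw [eval_eulerNumerator_eq_prod_mul_sum d a 0 hf]
  refine mul_ne_zero (Finset.prod_ne_zero_iff.2 fun j _ => hf j) (ne_of_gt ?_)
  refine Finset.sum_pos (fun j _ => ?_) ⟨⟨0, hm⟩, Finset.mem_univ _⟩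
  rw [(hev j).1, (hev j).2]
  have hpR : (0 : ℝ) < p := by exact_mod_cast hp
  exact hpR.trans (eulerRatio_gt_of_switched (a j 0) (a j 1) (a j 2) d0 p q hp hpq hx (hac j) (hsw j))

/-- ★ **No Euler zero where every factor is UNSWITCHED** (K = 3, `p ≤ q`; each factor incoherent one-zero type `a_{j0} a_{j1} ≤ 0`,
`a_{j0} a_{j2} ≤ 0` with `a_{j0}·f_j(x) > 0`, and some factor not a bottom monomial): `R(x) ≠ 0` — every Euler ratio is `≤ 0`, one `< 0`.
[this file's theorem] -/
theorem eulerNumerator_eval_ne_zero_of_all_unswitched {m : ℕ} (d0 p q : ℕ) (hp : 0 < p) (hpq : p ≤ q)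
    (a : Fin m → Fin 3 → ℝ) {x : ℝ} (hx : 0 < x) (hab : ∀ j, a j 0 * a j 1 ≤ 0) (hac : ∀ j, a j 0 * a j 2 ≤ 0)
    (hun : ∀ j, 0 < a j 0 * (a j 0 * x ^ d0 + a j 1 * x ^ (d0 + p) + a j 2 * x ^ (d0 + q)))
    (hnd : ∃ j, a j 1 ≠ 0 ∨ a j 2 ≠ 0) :
    (∑ j, (∑ l, C (a j l * (((![d0, d0 + p, d0 + q] : Fin 3 → ℕ) l : ℝ) - (![d0, d0 + p, d0 + q] : Fin 3 → ℕ) 0)) *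
        X ^ ((![d0, d0 + p, d0 + q] : Fin 3 → ℕ) l)) *
      ∏ i ∈ Finset.univ.erase j, (∑ l, C (a i l) * X ^ ((![d0, d0 + p, d0 + q] : Fin 3 → ℕ) l)) : ℝ[X]).eval x ≠ 0 := by
  classical
  set d : Fin 3 → ℕ := ![d0, d0 + p, d0 + q] with hd
  have hev := fun j => eval_trinomial_three d0 p q (a j) x
  have hf : ∀ j, (∑ l, C (a j l) * X ^ (d l) : ℝ[X]).eval x ≠ 0 := by
    intro j h
    have := hun j
    rw [← (hev j).1, h, mul_zero] at this
    exact lt_irrefl 0 this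
  rw [eval_eulerNumerator_eq_prod_mul_sum d a 0 hf]
  refine mul_ne_zero (Finset.prod_ne_zero_iff.2 fun j _ => hf j) (ne_of_lt ?_)
  -- every ratio is ≤ 0, and the nondegenerate factor's is < 0
  have hle : ∀ j, (X * derivative (∑ l, C (a j l) * X ^ (d l) : ℝ[X]) - C ((d 0 : ℕ) : ℝ) * ∑ l, C (a j l) * X ^ (d l)).eval x
      / (∑ l, C (a j l) * X ^ (d l) : ℝ[X]).eval x ≤ 0 := by
    intro j
    rw [(hev j).1, (hev j).2]
    have h := (puller_bound (a j 0) (a j 1) (a j 2) d0 p q hpq hx (hab j) (hac j) (hun j) _ rfl).1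
    linarith
  obtain ⟨j₀, hj₀⟩ := hnd
  have hlt : (X * derivative (∑ l, C (a j₀ l) * X ^ (d l) : ℝ[X]) - C ((d 0 : ℕ) : ℝ) * ∑ l, C (a j₀ l) * X ^ (d l)).eval x
      / (∑ l, C (a j₀ l) * X ^ (d l) : ℝ[X]).eval x < 0 := by
    rw [(hev j₀).1, (hev j₀).2]
    have ha0 : a j₀ 0 ≠ 0 := by intro h; have := hun j₀; rw [h, zero_mul] at this; exact lt_irrefl 0 this
    -- numerator·a < 0, denominator·a > 0
    have hnum : a j₀ 0 * ((p : ℝ) * a j₀ 1 * x ^ (d0 + p) + (q : ℝ) * a j₀ 2 * x ^ (d0 + q)) < 0 := by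
      have e1 : a j₀ 0 * ((p : ℝ) * a j₀ 1 * x ^ (d0 + p) + (q : ℝ) * a j₀ 2 * x ^ (d0 + q))
          = (p : ℝ) * (a j₀ 0 * a j₀ 1) * x ^ (d0 + p) + (q : ℝ) * (a j₀ 0 * a j₀ 2) * x ^ (d0 + q) := by ring
      rw [e1]
      have hpR : (0 : ℝ) < p := by exact_mod_cast hp
      have hqR : (0 : ℝ) < q := by exact_mod_cast (lt_of_lt_of_le hp hpq)
      have t1 : (p : ℝ) * (a j₀ 0 * a j₀ 1) * x ^ (d0 + p) ≤ 0 :=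
        mul_nonpos_of_nonpos_of_nonneg (mul_nonpos_of_nonneg_of_nonpos hpR.le (hab j₀)) (pow_pos hx _).le
      have t2 : (q : ℝ) * (a j₀ 0 * a j₀ 2) * x ^ (d0 + q) ≤ 0 :=
        mul_nonpos_of_nonpos_of_nonneg (mul_nonpos_of_nonneg_of_nonpos hqR.le (hac j₀)) (pow_pos hx _).le
      rcases hj₀ with h1 | h2
      · have : a j₀ 0 * a j₀ 1 < 0 := lt_of_le_of_ne (hab j₀) (mul_ne_zero ha0 h1)
        have : (p : ℝ) * (a j₀ 0 * a j₀ 1) * x ^ (d0 + p) < 0 :=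
          mul_neg_of_neg_of_pos (mul_neg_of_pos_of_neg hpR this) (pow_pos hx _)
        linarith
      · have : a j₀ 0 * a j₀ 2 < 0 := lt_of_le_of_ne (hac j₀) (mul_ne_zero ha0 h2)
        have : (q : ℝ) * (a j₀ 0 * a j₀ 2) * x ^ (d0 + q) < 0 :=
          mul_neg_of_neg_of_pos (mul_neg_of_pos_of_neg hqR this) (pow_pos hx _)
        linarith
    have e2 : ((p : ℝ) * a j₀ 1 * x ^ (d0 + p) + (q : ℝ) * a j₀ 2 * x ^ (d0 + q))
          / (a j₀ 0 * x ^ d0 + a j₀ 1 * x ^ (d0 + p) + a j₀ 2 * x ^ (d0 + q))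
        = (a j₀ 0 * ((p : ℝ) * a j₀ 1 * x ^ (d0 + p) + (q : ℝ) * a j₀ 2 * x ^ (d0 + q)))
          / (a j₀ 0 * (a j₀ 0 * x ^ d0 + a j₀ 1 * x ^ (d0 + p) + a j₀ 2 * x ^ (d0 + q))) := by
      rw [mul_div_mul_left _ _ ha0]
    rw [e2]
    exact div_neg_of_neg_of_pos hnum (hun j₀)
  calc ∑ j, (X * derivative (∑ l, C (a j l) * X ^ (d l) : ℝ[X]) - C ((d 0 : ℕ) : ℝ) * ∑ l, C (a j l) * X ^ (d l)).eval x
          / (∑ l, C (a j l) * X ^ (d l) : ℝ[X]).eval x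
      < ∑ _j : Fin m, (0 : ℝ) := Finset.sum_lt_sum (fun j _ => hle j) ⟨j₀, Finset.mem_univ _, hlt⟩
    _ = 0 := by simp

end ProductPlusOne

end Summit.ValiantsHypothesis.ValiantsHypothesis.Theorems.LacunarySymmetroidMatrixDescartes
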